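import Mathlib
import HarnessLib
import Literature.Combinatorics.SimpleGraph.TreeDecomposition
import Literature.Combinatorics.SimpleGraph.SubcubicMinors
import Literature.Combinatorics.SimpleGraph.TreewidthBrambleLowerBound
import Literature.ModelTheory.FiniteModelTheory.CFIUncolouredProofs

/-!
# Route MonotoneRestoration, crux `MonotoneRestorationQP` (stmt-15886), line `linear_width` —
# TREE-WIDTH IS MINOR-MONOTONE; the 2-subdivision `G₂` is at least as wide as `G`

Helper file (`--supports stmt-ValiantsHypothesis-15886`), def-free.  Step (P2') of the g13 census: the apex witnesses of
`CFIHomMonotoneApex` (p841446) separate every bipartite pattern containing an induced copy of `subdiv B` for a base `B` with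
`tw B ≥ k`; to know that such patterns are exactly the WIDE ones (and to bound `tw` of the bases a wall normalisation will
produce) one needs that tree-width does not drop under taking minors and, in particular, under 2-subdivision.  The tree has
subgraph monotonicity (`treewidth_le_of_hom_injective`) and the minor relation `IsMinor` (branch-set form,
`SubcubicMinors.lean`) but not minor monotonicity; this file supplies it:

* `connected_induce_bags_of_walk` — along a walk of `G`, the union of the tree nodes whose bags meet the walk is connected
  (consecutive vertices share a bag by (T2), each vertex's nodes are connected by (T3));
* `treewidth_le_of_isMinor` — **`H ≼ₘ G ⇒ tw H ≤ tw G`** (project every bag through the branch-set map; widths do not grow,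
  (T3) for a branch set follows from its connectivity and the previous lemma);
* `isMinor_subdiv` — `G ≼ₘ G₂` (contract every dart vertex `w_{u,v}` onto `u`); hence
  `treewidth_le_treewidth_subdiv` — **`tw G ≤ tw G₂`**, and `le_treewidth_subdiv_grid` — the 2-subdivided `(k+1)×(k+1)` grid
  (on `Fin ((k+1)²)`) has tree-width `≥ k`: the patterns handled by the grid witnesses ARE wide.

Honest label: library-type facts (Diestel §12.3) recorded on the line that needs them; no stub closed; θ₁, the cruxes and
VP ≠ VNP NOT moved. [cite: Diestel2010, §12.3 (Prop. 12.3.6 context: tree-width and minors); BondyMurty2008, §10.5]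
-/

set_option linter.dupNamespace false

noncomputable section

open scoped Classical
open scoped Literature.Combinatorics.SimpleGraph

namespace Summit.ValiantsHypothesis.ValiantsHypothesis.Theorems.CFIHomMonotone

open Literature.Combinatorics.SimpleGraph (TreeDecomposition treewidth IsMinor)
open Literature.ModelTheory.FiniteModelTheory Literature.ModelTheory.FiniteModelTheory.ChenFlumLiu2025

/-! ### Tree-width is minor-monotone -/

/-- Along a walk `p` of `G`, the tree nodes of a tree decomposition whose bags contain SOME vertex of `p` induce a
connected subgraph of the decomposition tree. [cite: Diestel2010, §12.3] -/
theorem connected_induce_bags_of_walk {β ι : Type*} {G : SimpleGraph β} (D : TreeDecomposition G ι)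
    {x y : β} (p : G.Walk x y) :
    (D.tree.induce {t | ∃ z ∈ p.support, z ∈ D.bag t}).Connected := by
  induction p with
  | nil =>
    rename_i u
    have hset : {t | ∃ z ∈ (SimpleGraph.Walk.nil : G.Walk u u).support, z ∈ D.bag t} = {t | u ∈ D.bag t} := by
      ext t; simp
    rw [hset]
    exact D.connected_induce u
  | cons h p ih =>
    rename_i u w v
    have hset : {t | ∃ z ∈ (SimpleGraph.Walk.cons h p).support, z ∈ D.bag t} =
        {t | u ∈ D.bag t} ∪ {t | ∃ z ∈ p.support, z ∈ D.bag t} := by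
      ext t; simp [SimpleGraph.Walk.support_cons]
    rw [hset]
    obtain ⟨t₀, hu, hw⟩ := D.exists_mem_bag_of_adj h
    exact SimpleGraph.induce_union_connected (D.connected_induce u).preconnected ih.preconnected
      ⟨t₀, hu, w, p.start_mem_support, hw⟩

/-- **TREE-WIDTH IS MINOR-MONOTONE**: if `H` is a minor of `G` (tree `IsMinor`: a partial map of `V(G)` onto `V(H)` with
nonempty connected branch sets covering the edges of `H`) then `tw H ≤ tw G`.  Proof: push a tree decomposition of `G` of
optimal width through the branch-set map — bags do not grow, edges of `H` are covered because some `G`-edge between the two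
branch sets is, and the nodes seeing a branch set form a connected subtree because the branch set is connected.
[cite: Diestel2010, §12.3] -/
theorem treewidth_le_of_isMinor {α β : Type*} [Fintype α] [Fintype β] {H : SimpleGraph α} {G : SimpleGraph β}
    (h : H ≼ₘ G) : treewidth H ≤ treewidth G := by
  classical
  obtain ⟨φ, hne, hconn, hadj⟩ := h
  obtain ⟨k, D, hD⟩ := Literature.Combinatorics.SimpleGraph.exists_width_eq_treewidth G
  -- the projected decomposition
  let bag' : Fin k → Finset α := fun t => Finset.univ.filter fun u => ∃ x ∈ D.bag t, φ x = some u
  have hmem : ∀ t u, u ∈ bag' t ↔ ∃ x ∈ D.bag t, φ x = some u := fun t u => by simp [bag']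
  let D' : TreeDecomposition H (Fin k) :=
    { tree := D.tree
      isTree := D.isTree
      bag := bag'
      exists_mem_bag_of_adj := fun u v huv => by
        obtain ⟨x, y, hx, hy, hxy⟩ := hadj u v huv
        obtain ⟨t, hxt, hyt⟩ := D.exists_mem_bag_of_adj hxy
        exact ⟨t, (hmem t u).2 ⟨x, hxt, hx⟩, (hmem t v).2 ⟨y, hyt, hy⟩⟩
      connected_induce := fun u => by
        obtain ⟨x₀, hx₀⟩ := hne u
        obtain ⟨t₀, ht₀⟩ := D.exists_mem_bag x₀
        have hset : {t | u ∈ bag' t} = {t | ∃ x ∈ D.bag t, φ x = some u} := by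
          ext t; exact hmem t u
        rw [hset]
        refine SimpleGraph.induce_connected_of_patches t₀ ⟨x₀, ht₀, hx₀⟩ fun {t} ht => ?_
        obtain ⟨x, hxt, hx⟩ := ht
        obtain ⟨p, hp⟩ := hconn x₀ x (hx₀.trans hx.symm) (by rw [hx₀]; exact Option.some_ne_none u)
        refine ⟨{t | ∃ z ∈ p.support, z ∈ D.bag t}, fun t' ⟨z, hz, hzt'⟩ => ⟨z, hzt', (hp z hz).trans hx₀⟩,
          ⟨x₀, p.start_mem_support, ht₀⟩, ⟨x, p.end_mem_support, hxt⟩, ?_⟩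
        exact (connected_induce_bags_of_walk D p).preconnected _ _ }
  have hcard : ∀ t, (D'.bag t).card ≤ (D.bag t).card := fun t => by
    calc (bag' t).card ≤ ((D.bag t).image φ).card :=
          Finset.card_le_card_of_injOn (fun u => some u) (fun u hu => by
            obtain ⟨x, hxt, hx⟩ := (hmem t u).1 (Finset.mem_coe.1 hu)
            exact Finset.mem_coe.2 (Finset.mem_image.2 ⟨x, hxt, hx⟩))
            (fun u _ v _ huv => Option.some_injective _ huv)
      _ ≤ (D.bag t).card := Finset.card_image_le
  have hw : D'.width ≤ D.width :=
    D'.width_le fun t => (hcard t).trans (D.card_bag_le_width_add_one t)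
  rw [← hD]
  exact (Literature.Combinatorics.SimpleGraph.treewidth_le_width D').trans hw

/-! ### The 2-subdivision is at least as wide -/

variable {v : ℕ} (G : SimpleGraph (Fin v))

/-- **`G` is a minor of its 2-subdivision `G₂`**: contract every dart vertex `w_{u,w}` onto its tail `u` (branch set of
`u` = `{u} ∪ {w_{u,w}}`, a star). [cite: Diestel2010, §1.7] -/
theorem isMinor_subdiv : G ≼ₘ subdiv G := by
  let φ : Fin v ⊕ Dart G → Option (Fin v) := Sum.elim (fun u => some u) (fun d => some d.1.1)
  have hφl : ∀ u : Fin v, φ (.inl u) = some u := fun _ => rfl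
  have hφr : ∀ d : Dart G, φ (.inr d) = some d.1.1 := fun _ => rfl
  refine ⟨φ, fun u => ⟨.inl u, hφl u⟩, ?_, ?_⟩
  · -- branch sets are stars around `inl u`
    have key : ∀ (x : Fin v ⊕ Dart G) (u : Fin v), φ x = some u →
        ∃ p : (subdiv G).Walk x (.inl u), ∀ z ∈ p.support, φ z = some u := by
      rintro (u' | d) u hx
      · rw [hφl, Option.some.injEq] at hx
        subst hx
        exact ⟨SimpleGraph.Walk.nil, fun z hz => by
          rw [SimpleGraph.Walk.support_nil, List.mem_singleton] at hz
          rw [hz]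
          exact hφl u'⟩
      · rw [hφr, Option.some.injEq] at hx
        subst hx
        have hadj : (subdiv G).Adj (.inr d) (.inl d.1.1) := (subdiv_adj_inr_inl G d.1.1 d).2 rfl
        refine ⟨SimpleGraph.Walk.cons hadj SimpleGraph.Walk.nil, fun z hz => ?_⟩
        rw [SimpleGraph.Walk.support_cons, SimpleGraph.Walk.support_nil, List.mem_cons,
          List.mem_singleton] at hz
        rcases hz with rfl | rfl
        · exact hφr d
        · exact hφl _
    intro x y hxy hxnone
    obtain ⟨u, hu⟩ : ∃ u, φ x = some u := Option.ne_none_iff_exists'.1 hxnone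
    obtain ⟨p, hp⟩ := key x u hu
    obtain ⟨q, hq⟩ := key y u (hxy.symm.trans hu)
    refine ⟨p.append q.reverse, fun z hz => ?_⟩
    rw [SimpleGraph.Walk.mem_support_append_iff] at hz
    rw [hu]
    rcases hz with hz | hz
    · exact hp z hz
    · rw [SimpleGraph.Walk.support_reverse, List.mem_reverse] at hz
      exact hq z hz
  · intro u w huw
    exact ⟨.inr ⟨(u, w), huw⟩, .inr ⟨(w, u), huw.symm⟩, hφr _, hφr _, (subdiv_adj_inr_inr G _ _).2 rfl⟩

/-- **`tw G ≤ tw G₂`.** [cite: Diestel2010, §12.3] -/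
theorem treewidth_le_treewidth_subdiv : treewidth G ≤ treewidth (subdiv G) :=
  treewidth_le_of_isMinor (isMinor_subdiv G)

/-- **The 2-subdivided grids are wide**: the 2-subdivision of the `(k+1) × (k+1)` grid (transported to `Fin ((k+1)²)`)
has tree-width `≥ k` — so the patterns separated by the grid witnesses of `CFIHomMonotone` / `CFIHomMonotoneApex` are
genuinely wide. [cite: BondyMurty2008, §10.5; Diestel2010, §12.3] -/
theorem le_treewidth_subdiv_grid (k : ℕ) :
    k ≤ treewidth (subdiv ((Literature.Combinatorics.SimpleGraph.grid k k).map
      (Fintype.equivFin (Fin (k + 1) × Fin (k + 1))).toEmbedding)) := by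
  have h1 : k ≤ treewidth (Literature.Combinatorics.SimpleGraph.grid k k) := by
    simpa using Literature.Combinatorics.SimpleGraph.min_le_treewidth_grid k k
  have h2 : treewidth (Literature.Combinatorics.SimpleGraph.grid k k) ≤
      treewidth ((Literature.Combinatorics.SimpleGraph.grid k k).map
        (Fintype.equivFin (Fin (k + 1) × Fin (k + 1))).toEmbedding) :=
    Literature.Combinatorics.SimpleGraph.treewidth_le_of_hom_injective
      (SimpleGraph.Iso.map (Fintype.equivFin _) _).toEmbedding.toHom
      (SimpleGraph.Iso.map (Fintype.equivFin _) _).injective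
  exact h1.trans (h2.trans (treewidth_le_treewidth_subdiv _))

end Summit.ValiantsHypothesis.ValiantsHypothesis.Theorems.CFIHomMonotone

end
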